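import Summits.ResolutionOfSingularities.ResolutionOfSingularities.Theorems.PAlterationAssemblyRadicialSections
import Summits.ResolutionOfSingularities.ResolutionOfSingularities.Theorems.PAlterationAssemblyPerfect
import HarnessLib

/-!
# `PAlteration.PicoverToRadicialBottom` (stmt-ResolutionOfSingularities-0556): the generic Frobenius factor of a finite radicial cover

Route `ResolutionOfSingularities/pAlteration`, item `PicoverToRadicialBottom` (stmt-0556), line
`theta-finite-cofinite-roots`; helper file (`--supports`), stub `stub_frobeniusFactorGeneric`.

**Theorem** (`stub_frobeniusFactorGeneric`). Let `ρ : Z → X` be a surjective morphism of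
integral schemes with `p = 0` on `X`, finite and universally injective over a non-empty open
`U ⊆ X`. Then there are a non-empty affine open `W ⊆ U`, an exponent `N` and a ring
homomorphism `σ : Γ(ρ⁻¹W) → Γ(W)` with `ρ^* ∘ σ = Frob^N` and `σ ∘ ρ^* = Frob^N`.

Proof (no normality of `X` is used, contrary to `exists_frobeniusFactor_app`). On an affine
open `V ⊆ U` the homomorphism `φ = ρ^* : A = Γ(V) → C = Γ(ρ⁻¹V)` is finite and every `c ∈ C`
satisfies `φ(s) · c^{p^n} = φ(a)` with `s ≠ 0` (`exists_mul_pow_eq_of_universallyInjective`).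
Clearing denominators on finitely many module generators and using the additivity of
`x ↦ x^{p^N}` gives ONE `s ≠ 0` and ONE `N` with `φ(s) · C^{p^N} ⊆ φ(A)`. On the basic open
`W = D(s) ⊆ V` the sections are the localisations `A_s → C_{φ(s)}`, hence
`Γ(ρ⁻¹W)^{p^N} ⊆ ρ^* Γ(W)`; as `ρ^*` is injective over `W` (dominance), `σ` is the unique
preimage map.
-/

-- single-problem summit: the doubled namespace component `ResolutionOfSingularities` is forced
set_option linter.dupNamespace false

noncomputable section

open CategoryTheory CategoryTheory.Limits AlgebraicGeometry TopologicalSpace Topology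

namespace Summit.ResolutionOfSingularities.ResolutionOfSingularities.Theorems

universe u

/-! ## Commutative algebra -/

/-- A common denominator: if `φ : A → C` is finite, `C` has characteristic `p`, `A` is a domain
and every `c ∈ C` satisfies `φ(s) · c^{p^n} = φ(a)` for some `n` and some `s ≠ 0`, then there
are a single `s ≠ 0` and a single `N` with `φ(s) · c^{p^N} ∈ φ(A)` for every `c`. [folklore] -/
theorem exists_ne_zero_forall_mul_pow_mem {A C : Type*} [CommRing A] [IsDomain A] [CommRing C]
    (φ : A →+* C) (hfin : φ.Finite) (p : ℕ) [Fact p.Prime] [CharP C p]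
    (hrad : ∀ c : C, ∃ (n : ℕ) (a s : A), s ≠ 0 ∧ φ s * c ^ p ^ n = φ a) :
    ∃ (s : A) (N : ℕ), s ≠ 0 ∧ ∀ c : C, ∃ a : A, φ s * c ^ p ^ N = φ a := by
  classical
  letI : Algebra A C := φ.toAlgebra
  haveI : Module.Finite A C := hfin
  obtain ⟨S, hS⟩ := Module.finite_def.mp ‹Module.Finite A C›
  choose n a s hs h using hrad
  -- a uniform exponent on the generators, with denominators `t c := (s c)^(p^(N - n c))`
  set N : ℕ := S.sup n with hN
  set t : C → A := fun c => s c ^ p ^ (N - n c) with ht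
  have ht0 : ∀ c, t c ≠ 0 := fun c => pow_ne_zero _ (hs c)
  have htc : ∀ c ∈ S, φ (t c) * c ^ p ^ N = φ (a c ^ p ^ (N - n c)) := by
    intro c hc
    have hle : n c ≤ N := Finset.le_sup hc
    have hpow : c ^ p ^ N = (c ^ p ^ n c) ^ p ^ (N - n c) := by
      rw [← pow_mul, ← pow_add, Nat.add_sub_cancel' hle]
    rw [hpow, ht, map_pow, ← mul_pow, h, map_pow]
  -- the common denominator is the product of the `t c`
  refine ⟨∏ c ∈ S, t c, N, Finset.prod_ne_zero_iff.mpr fun c _ => ht0 c, ?_⟩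
  have hgen : ∀ c ∈ S, ∃ b : A, φ (∏ c' ∈ S, t c') * c ^ p ^ N = φ b := by
    intro c hc
    refine ⟨(∏ c' ∈ S.erase c, t c') * a c ^ p ^ (N - n c), ?_⟩
    rw [map_mul, ← htc c hc, ← mul_assoc, ← map_mul, Finset.prod_erase_mul _ _ hc]
  intro c
  have hc : c ∈ Submodule.span A (S : Set C) := by rw [hS]; exact Submodule.mem_top
  induction hc using Submodule.span_induction with
  | mem x hx => exact hgen x hx
  | zero =>
    exact ⟨0, by rw [map_zero, zero_pow (pow_ne_zero N (Fact.out : p.Prime).ne_zero), mul_zero]⟩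
  | add x y _ _ hx hy =>
    obtain ⟨bx, hbx⟩ := hx
    obtain ⟨by', hby⟩ := hy
    exact ⟨bx + by', by rw [add_pow_char_pow x y p N, mul_add, hbx, hby, map_add]⟩
  | smul r x _ hx =>
    obtain ⟨bx, hbx⟩ := hx
    refine ⟨r ^ p ^ N * bx, ?_⟩
    rw [Algebra.smul_def, mul_pow, mul_left_comm, hbx, map_mul, map_pow]
    rfl

/-- Localisation step: in a commutative square `φ' ∘ rA = rC ∘ φ₀` of ring homomorphisms in
which `rA s` is a unit and every element of `C'` is a fraction `rC(c) / rC(φ₀ s)^e`, the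
inclusion `φ₀(s) · C₀^M ⊆ φ₀(A₀)` implies `C'^M ⊆ φ'(A')`. [folklore] -/
theorem forall_exists_map_eq_pow_of_isUnit {A₀ C₀ A' C' : Type*} [CommRing A₀] [CommRing C₀]
    [CommRing A'] [CommRing C'] (φ₀ : A₀ →+* C₀) (φ' : A' →+* C') (rA : A₀ →+* A')
    (rC : C₀ →+* C') (hcomm : ∀ a, φ' (rA a) = rC (φ₀ a)) {s : A₀} (hs : IsUnit (rA s))
    {M : ℕ} (H1 : ∀ c : C₀, ∃ a : A₀, φ₀ s * c ^ M = φ₀ a)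
    (H2 : ∀ y : C', ∃ (c : C₀) (e : ℕ), y * rC (φ₀ s) ^ e = rC c) :
    ∀ y : C', ∃ x : A', φ' x = y ^ M := by
  intro y
  obtain ⟨c, e, hy⟩ := H2 y
  obtain ⟨a, ha⟩ := H1 c
  obtain ⟨u, hu⟩ := hs
  have hφu : φ' u = rC (φ₀ s) := by rw [hu, hcomm]
  have h1 : y ^ M * rC (φ₀ s) ^ (e * M) = rC c ^ M := by
    rw [pow_mul, ← mul_pow, hy]
  -- `y^M · rC(φ₀ s)^(e M + 1) = φ'(rA a)`
  have key : y ^ M * φ' u ^ (e * M + 1) = φ' (rA a) := by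
    rw [hφu, hcomm, ← ha, map_mul, map_pow, ← h1, pow_succ, ← mul_assoc, mul_comm (rC (φ₀ s))]
  refine ⟨rA a * ↑u⁻¹ ^ (e * M + 1), ?_⟩
  rw [map_mul, map_pow, ← key, mul_assoc, ← mul_pow, ← map_mul, Units.mul_inv, map_one, one_pow,
    mul_one]

/-- If `φ : A → C` is injective, `C` has characteristic `p` and every `p^N`-th power lies in the
image of `φ`, then `c ↦ φ⁻¹(c^{p^N})` is a ring homomorphism `σ : C → A` with `φ ∘ σ = Frob^N`
and `σ ∘ φ = Frob^N`. [folklore] -/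
theorem exists_hom_map_eq_pow_of_injective {A C : Type*} [CommRing A] [CommRing C]
    (φ : A →+* C) (hφ : Function.Injective φ) (p : ℕ) [Fact p.Prime] [CharP C p] (N : ℕ)
    (hall : ∀ c : C, ∃ b : A, φ b = c ^ p ^ N) :
    ∃ σ : C →+* A, (∀ c, φ (σ c) = c ^ p ^ N) ∧ ∀ a, σ (φ a) = a ^ p ^ N := by
  choose s hs using hall
  have hs1 : s 1 = 1 := hφ (by rw [hs, one_pow, map_one])
  have hsmul : ∀ x y, s (x * y) = s x * s y := fun x y =>
    hφ (by rw [hs, map_mul, hs, hs, mul_pow])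
  have hs0 : s 0 = 0 := hφ (by
    rw [hs, map_zero, zero_pow (pow_ne_zero N (Fact.out : p.Prime).ne_zero)])
  have hsadd : ∀ x y, s (x + y) = s x + s y := fun x y =>
    hφ (by rw [hs, map_add, hs, hs, add_pow_char_pow x y p N])
  let σ : C →+* A :=
    { toFun := s, map_one' := hs1, map_mul' := hsmul, map_zero' := hs0, map_add' := hsadd }
  refine ⟨σ, fun c => hs c, fun a => hφ ?_⟩
  change φ (s (φ a)) = φ (a ^ p ^ N)
  rw [hs, map_pow]

/-! ## Restriction to an open of the target, on global sections -/

section Restrict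

variable {X Y : Scheme.{u}} (f : X ⟶ Y) (U : Y.Opens)

/-- On global sections, `f ∣_ U` is `f^* : Γ(Y, U) → Γ(X, f⁻¹U)` transported along the
canonical isomorphisms `Γ(U, ⊤) ≅ Γ(Y, U)` and `Γ(f⁻¹U, ⊤) ≅ Γ(X, f⁻¹U)`. [folklore] -/
theorem morphismRestrict_appTop_eq_topIso :
    (f ∣_ U).appTop = U.topIso.hom ≫ f.app U ≫ (f ⁻¹ᵁ U).topIso.inv := by
  rw [← Scheme.Hom.resLE_eq_morphismRestrict]
  change (Scheme.Hom.resLE f U (f ⁻¹ᵁ U) le_rfl).app ⊤ = _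
  rw [Scheme.Hom.resLE_app_top, Scheme.Hom.appLE_eq_app]

/-- Elementwise form of `morphismRestrict_appTop_eq_topIso`. [folklore] -/
theorem topIso_hom_morphismRestrict_appTop_apply (x : Γ(U, ⊤)) :
    (f ⁻¹ᵁ U).topIso.hom ((f ∣_ U).appTop x) = f.app U (U.topIso.hom x) := by
  rw [morphismRestrict_appTop_eq_topIso, CommRingCat.comp_apply, CommRingCat.comp_apply,
    CommRingCat.hom_inv_apply]

end Restrict


/-! ## The stub -/

/-- (T1) **Generic Frobenius factor of a finite radicial cover, after shrinking.** For
`ρ : Z → X` surjective between integral schemes of characteristic `p`, finite and universally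
injective over a non-empty open `U`, there is a non-empty affine open `W ≤ U` and `N` such that
the `p^N`-th power map of `Γ(ρ⁻¹ W)` factors through `Γ(W)` (no normality: clear the
denominators of `exists_mul_pow_eq_of_universallyInjective` on module generators and pass to a
basic open). [folklore] -/
theorem stub_frobeniusFactorGeneric :
    ∀ (p : ℕ) [Fact p.Prime] (Z X : Scheme.{0}) [IsIntegral Z] [IsIntegral X] (ρ : Z ⟶ X)
      [Surjective ρ] (U : X.Opens) [Nonempty ↥U] [IsFinite (ρ ∣_ U)]
      [UniversallyInjective (ρ ∣_ U)], (p : Γ(X, ⊤)) = 0 →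
      ∃ (W : X.Opens) (_ : IsAffineOpen W) (_ : Nonempty ↥W) (_ : W ≤ U) (N : ℕ)
        (σ : Γ(↑(ρ ⁻¹ᵁ W), ⊤) →+* Γ(↑W, ⊤)),
        (∀ c, (ρ ∣_ W).appTop (σ c) = c ^ p ^ N) ∧ ∀ a, σ ((ρ ∣_ W).appTop a) = a ^ p ^ N := by
  intro p _ Z X _ _ ρ _ U hU hUfin hUui hp
  -- Step 1: a non-empty affine open `V ⊆ U` and the instances on `ρ ∣_ V`
  obtain ⟨⟨u, hu⟩⟩ := hU
  obtain ⟨V, hV, huV, hVU⟩ : ∃ V : X.Opens, V ∈ X.affineOpens ∧ u ∈ V ∧ V ≤ U :=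
    Opens.isBasis_iff_nbhd.mp X.isBasis_affineOpens hu
  have hVaff : IsAffineOpen V := hV
  haveI : IsAffine V := hVaff
  haveI : IsFinite (ρ ∣_ V) := restrict_of_le ρ hVU hUfin
  haveI : UniversallyInjective (ρ ∣_ V) := restrict_of_le ρ hVU hUui
  haveI : Nonempty V := ⟨⟨u, huV⟩⟩
  haveI : IsIntegral (V : Scheme.{0}) := isIntegral_of_isOpenImmersion V.ι
  obtain ⟨z, hz⟩ := ‹Surjective ρ›.1 u
  haveI : Nonempty (ρ ⁻¹ᵁ V) := ⟨⟨z, show ρ.base z ∈ V by rw [hz]; exact huV⟩⟩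
  haveI : IsIntegral (ρ ⁻¹ᵁ V : Scheme.{0}) := isIntegral_of_isOpenImmersion (ρ ⁻¹ᵁ V).ι
  haveI : Surjective (ρ ∣_ V) := IsZariskiLocalAtTarget.restrict ‹Surjective ρ› V
  have hpV : (p : Γ((V : Scheme.{0}), ⊤)) = 0 := by
    rw [← map_natCast V.ι.appTop.hom p, hp, map_zero]
  -- Step 2: one denominator `s ≠ 0` and one exponent `N` over `V`
  haveI : Nonempty ((ρ ∣_ V) ⁻¹ᵁ (⊤ : (V : Scheme.{0}).Opens)) :=
    ⟨⟨Classical.arbitrary _, trivial⟩⟩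
  haveI : Nonempty (⊤ : (V : Scheme.{0}).Opens) := ⟨⟨Classical.arbitrary _, trivial⟩⟩
  have hpC : (p : Γ((ρ ⁻¹ᵁ V : Scheme.{0}), ⊤)) = 0 := by
    rw [← map_natCast (ρ ∣_ V).appTop.hom p, hpV, map_zero]
  haveI : CharP Γ((ρ ⁻¹ᵁ V : Scheme.{0}), ⊤) p :=
    (CharP.charP_iff_prime_eq_zero Fact.out).mpr hpC
  obtain ⟨s, N, hs, H1⟩ := exists_ne_zero_forall_mul_pow_mem (ρ ∣_ V).appTop.hom
    (ρ ∣_ V).finite_appTop p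
    (exists_mul_pow_eq_of_universallyInjective (ρ ∣_ V) p hpV ⊤ (isAffineOpen_top _))
  -- Step 3: transport to `ρ^* : Γ(X, V) → Γ(Z, ρ⁻¹V)`
  set s₁ : Γ(X, V) := V.topIso.hom s with hs₁def
  have hs₁ : s₁ ≠ 0 := by
    intro h0
    apply hs
    have h0' := congrArg V.topIso.inv h0
    rwa [hs₁def, CommRingCat.inv_hom_apply, map_zero] at h0'
  have H1' : ∀ c : Γ(Z, ρ ⁻¹ᵁ V), ∃ a : Γ(X, V), ρ.app V s₁ * c ^ p ^ N = ρ.app V a := by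
    intro c
    obtain ⟨a, ha⟩ := H1 ((ρ ⁻¹ᵁ V).topIso.inv c)
    refine ⟨V.topIso.hom a, ?_⟩
    have ha' := congrArg (ρ ⁻¹ᵁ V).topIso.hom ha
    rw [map_mul, map_pow, CommRingCat.hom_inv_apply] at ha'
    rw [hs₁def, ← topIso_hom_morphismRestrict_appTop_apply,
      ← topIso_hom_morphismRestrict_appTop_apply]
    exact ha'
  -- Step 4: the basic open `W = D(s₁) ⊆ V` and the localisation of the sections
  have hWV : X.basicOpen s₁ ≤ V := X.basicOpen_le s₁
  have hW : IsAffineOpen (X.basicOpen s₁) := hVaff.basicOpen s₁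
  have hWne : Nonempty ↥(X.basicOpen s₁) := by
    have hne : X.basicOpen s₁ ≠ ⊥ := by
      rw [Ne, basicOpen_eq_bot_iff]
      exact hs₁
    obtain ⟨x, hx⟩ := (Opens.ne_bot_iff_nonempty _).mp hne
    exact ⟨⟨x, hx⟩⟩
  have hρV : IsAffineOpen (ρ ⁻¹ᵁ V) := isAffine_of_isAffineHom (ρ ∣_ V)
  -- every section over `ρ⁻¹ W = D(ρ^* s₁)` is a fraction with denominator a power of `ρ^* s₁`
  have H2 : ∀ (O : Z.Opens) (hO : O ≤ ρ ⁻¹ᵁ V), O = Z.basicOpen (ρ.app V s₁) →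
      ∀ y : Γ(Z, O), ∃ (c : Γ(Z, ρ ⁻¹ᵁ V)) (e : ℕ),
        y * Z.presheaf.map (homOfLE hO).op (ρ.app V s₁) ^ e = Z.presheaf.map (homOfLE hO).op c := by
    rintro O hO rfl y
    haveI := hρV.isLocalization_basicOpen (ρ.app V s₁)
    obtain ⟨⟨c, ⟨_, e, rfl⟩⟩, hce⟩ := IsLocalization.surj (Submonoid.powers (ρ.app V s₁)) y
    refine ⟨c, e, ?_⟩
    rw [← map_pow]
    exact hce
  have hρWV : ρ ⁻¹ᵁ X.basicOpen s₁ ≤ ρ ⁻¹ᵁ V := ρ.preimage_mono hWV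
  have H2' := H2 (ρ ⁻¹ᵁ X.basicOpen s₁) hρWV (Scheme.preimage_basicOpen ρ s₁)
  -- `s₁` is a unit over `W`
  have hunit : IsUnit (X.presheaf.map (homOfLE hWV).op s₁) := by
    haveI := hVaff.isLocalization_basicOpen s₁
    exact IsLocalization.Away.algebraMap_isUnit (S := Γ(X, X.basicOpen s₁)) s₁
  -- the square `ρ^*_W ∘ res = res ∘ ρ^*_V`
  have hcomm : ∀ a : Γ(X, V), ρ.app (X.basicOpen s₁) (X.presheaf.map (homOfLE hWV).op a) =
      Z.presheaf.map (homOfLE hρWV).op (ρ.app V a) := by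
    intro a
    rw [← CommRingCat.comp_apply, ← CommRingCat.comp_apply, ρ.naturality]
    rfl
  -- Step 5: every `p^N`-th power over `ρ⁻¹W` comes from `W`
  have hall : ∀ y : Γ(Z, ρ ⁻¹ᵁ X.basicOpen s₁), ∃ x : Γ(X, X.basicOpen s₁),
      ρ.app (X.basicOpen s₁) x = y ^ p ^ N :=
    forall_exists_map_eq_pow_of_isUnit (ρ.app V).hom (ρ.app (X.basicOpen s₁)).hom
      (X.presheaf.map (homOfLE hWV).op).hom (Z.presheaf.map (homOfLE hρWV).op).hom hcomm hunit
      H1' H2'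
  -- transported to the restricted morphism `ρ ∣_ W`
  set W : X.Opens := X.basicOpen s₁ with hWdef
  have hall' : ∀ y : Γ(↑(ρ ⁻¹ᵁ W), ⊤), ∃ x : Γ(↑W, ⊤), (ρ ∣_ W).appTop x = y ^ p ^ N := by
    intro y
    obtain ⟨x, hx⟩ := hall ((ρ ⁻¹ᵁ W).topIso.hom y)
    refine ⟨W.topIso.inv x, (ρ ⁻¹ᵁ W).topIso.commRingCatIsoToRingEquiv.injective ?_⟩
    change (ρ ⁻¹ᵁ W).topIso.hom _ = (ρ ⁻¹ᵁ W).topIso.hom _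
    rw [topIso_hom_morphismRestrict_appTop_apply, CommRingCat.hom_inv_apply, hx, map_pow]
  -- Step 6: `ρ ∣_ W` is dominant, hence injective on sections; build `σ`
  haveI : IsFinite (ρ ∣_ W) := restrict_of_le ρ (hWV.trans hVU) hUfin
  haveI : Surjective (ρ ∣_ W) := IsZariskiLocalAtTarget.restrict ‹Surjective ρ› W
  haveI : IsSchemeTheoreticallyDominant (ρ ∣_ W) := .of_isDominant _
  have hinj : Function.Injective (ρ ∣_ W).appTop.hom := (ρ ∣_ W).app_injective ⊤
  obtain ⟨⟨w, hw⟩⟩ := id hWne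
  obtain ⟨zw, hzw⟩ := ‹Surjective ρ›.1 w
  haveI : Nonempty (ρ ⁻¹ᵁ W) := ⟨⟨zw, show ρ.base zw ∈ W by rw [hzw]; exact hw⟩⟩
  haveI : IsIntegral (ρ ⁻¹ᵁ W : Scheme.{0}) := isIntegral_of_isOpenImmersion (ρ ⁻¹ᵁ W).ι
  have hpW : (p : Γ((ρ ⁻¹ᵁ W : Scheme.{0}), ⊤)) = 0 := by
    rw [← map_natCast ((ρ ∣_ W) ≫ W.ι).appTop.hom p, hp, map_zero]
  haveI : CharP Γ((ρ ⁻¹ᵁ W : Scheme.{0}), ⊤) p :=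
    (CharP.charP_iff_prime_eq_zero Fact.out).mpr hpW
  obtain ⟨σ, hσ1, hσ2⟩ := exists_hom_map_eq_pow_of_injective (ρ ∣_ W).appTop.hom hinj p N hall'
  exact ⟨W, hW, hWne, hWV.trans hVU, N, σ, hσ1, hσ2⟩

end Summit.ResolutionOfSingularities.ResolutionOfSingularities.Theorems

end
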